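import Mathlib
import Literature.NumberTheory.LFunctions.TaoLogChowlaMoebiusOfLiouville

/-!
# Sloped ladder, rung — atoms piece, part 1: progressions `{n : q ∣ a n + b}` and the squarefree switch

Route `LiouvilleShiftedTables` (Parity / GeneralizedHardyLittlewood), crux stmt-Parity-9389 (`PairsToGHL`),
line `sloped_ladder`, stub `stub_rungAtomsPart` (lead).  Elementary arithmetic used by the atoms piece of
Bombieri's asymptotic-sieve rung for an adjoined form `ψ(n) = a n + b` (`a ≥ 1`, `b ≥ 0`):

* `no_solution_of_not_dvd`, `exists_class_of_dvd` — the set `{n : q ∣ a n + b}` is empty unless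
  `g := gcd(a, q) ∣ b`, and then it is exactly one residue class modulo `q / g`;
* `card_filter_dvd_linear_le` — `#{n ≤ N : q ∣ a n + b} ≤ (a + b) N / q`;
* `liouville_sq_real`, `abs_liouville_real_eq_one`, `moebius_div_eq_liouville_mul_sum` — the squarefree
  switch `μ(k/e) = λ(k) λ(e) Σ_{j ≤ J, e j² ∣ k} μ(j)` (from the tree's
  `moebius_eq_liouville_mul_sqfreeInd`, `sqfreeInd_eq_sum_moebius` and complete multiplicativity of `λ`).

No definitions are introduced. [folklore]
-/

open Finset

namespace Summit.Parity.GeneralizedHardyLittlewood.Theorems.PairsToGHL.SlopedLadder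

namespace RungAtoms

open scoped ArithmeticFunction.Moebius

/-! ### The progression `{n : q ∣ a n + b}` -/

/-- If `gcd(a, q) ∤ b` then `q ∣ a n + b` has no solution. [folklore] -/
theorem no_solution_of_not_dvd {a b q : ℕ} (h : ¬ Nat.gcd a q ∣ b) (n : ℕ) : ¬ q ∣ a * n + b := by
  intro hq
  have hg : Nat.gcd a q ∣ a * n + b := (Nat.gcd_dvd_right a q).trans hq
  have hga : Nat.gcd a q ∣ a * n := (Nat.gcd_dvd_left a q).mul_right n
  exact h ((Nat.dvd_add_right hga).mp hg)

/-- If `g := gcd(a, q) ∣ b` (`a, q ≥ 1`) then `{n : q ∣ a n + b}` is ONE residue class modulo `q / g`: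
there is `ρ < q / g` with `q ∣ a n + b ↔ n ≡ ρ (mod q / g)` for every `n`. [folklore] -/
theorem exists_class_of_dvd {a b q : ℕ} (ha : 0 < a) (hq : 0 < q) (h : Nat.gcd a q ∣ b) :
    ∃ ρ : ℕ, ρ < q / Nat.gcd a q ∧ ∀ n : ℕ, (q ∣ a * n + b ↔ n ≡ ρ [MOD (q / Nat.gcd a q)]) := by
  set g : ℕ := Nat.gcd a q with hg
  have hg0 : 0 < g := Nat.gcd_pos_of_pos_left q ha
  obtain ⟨a₁, ha₁⟩ : g ∣ a := Nat.gcd_dvd_left a q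
  obtain ⟨q₁, hq₁⟩ : g ∣ q := Nat.gcd_dvd_right a q
  obtain ⟨b₁, hb₁⟩ := h
  have hq₁0 : 0 < q₁ := Nat.pos_of_ne_zero fun h0 => by simp [h0] at hq₁; omega
  have hqdiv : q / g = q₁ := by rw [hq₁, Nat.mul_div_cancel_left _ hg0]
  have hadiv : a / g = a₁ := by rw [ha₁, Nat.mul_div_cancel_left _ hg0]
  have hcop : Nat.Coprime a₁ q₁ := by
    have := Nat.coprime_div_gcd_div_gcd (m := a) (n := q) hg0
    rwa [← hg, hadiv, hqdiv] at this
  haveI : NeZero q₁ := ⟨hq₁0.ne'⟩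
  -- the class
  have hunit : IsUnit ((a₁ : ℕ) : ZMod q₁) := (ZMod.isUnit_iff_coprime a₁ q₁).mpr hcop
  set ρz : ZMod q₁ := -((b₁ : ℕ) : ZMod q₁) * ((a₁ : ℕ) : ZMod q₁)⁻¹ with hρz
  refine ⟨ρz.val, by rw [hqdiv]; exact ZMod.val_lt _, fun n => ?_⟩
  rw [hqdiv]
  -- `q ∣ a n + b ↔ q₁ ∣ a₁ n + b₁`
  have h1 : q ∣ a * n + b ↔ q₁ ∣ a₁ * n + b₁ := by
    rw [hq₁, ha₁, hb₁, show g * a₁ * n + g * b₁ = g * (a₁ * n + b₁) by ring]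
    exact Nat.mul_dvd_mul_iff_left hg0
  rw [h1, ← ZMod.natCast_eq_zero_iff, Nat.ModEq, ← ZMod.natCast_eq_natCast_iff',
    ZMod.natCast_val, ZMod.cast_id', id]
  push_cast
  constructor
  · intro h0
    have : ((n : ℕ) : ZMod q₁) = -((b₁ : ℕ) : ZMod q₁) * ((a₁ : ℕ) : ZMod q₁)⁻¹ := by
      have e1 : ((a₁ : ℕ) : ZMod q₁) * n = -(b₁ : ZMod q₁) := by linear_combination h0
      calc ((n : ℕ) : ZMod q₁) = (((a₁ : ℕ) : ZMod q₁)⁻¹ * (a₁ : ZMod q₁)) * n := by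
            rw [ZMod.inv_mul_of_unit _ hunit, one_mul]
        _ = ((a₁ : ℕ) : ZMod q₁)⁻¹ * (((a₁ : ℕ) : ZMod q₁) * n) := by ring
        _ = -((b₁ : ℕ) : ZMod q₁) * ((a₁ : ℕ) : ZMod q₁)⁻¹ := by rw [e1]; ring
    rw [this]
  · intro hn
    rw [hn]
    calc ((a₁ : ℕ) : ZMod q₁) * (-((b₁ : ℕ) : ZMod q₁) * ((a₁ : ℕ) : ZMod q₁)⁻¹) + b₁
        = -(b₁ : ZMod q₁) * (((a₁ : ℕ) : ZMod q₁) * ((a₁ : ℕ) : ZMod q₁)⁻¹) + b₁ := by ring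
      _ = 0 := by rw [ZMod.mul_inv_of_unit _ hunit]; ring

/-- **One class per modulus.** For `a, q ≥ 1` there is `ρ < q / gcd(a,q)` such that for every `n`:
`q ∣ a n + b ↔ (gcd(a,q) ∣ b ∧ n ≡ ρ (mod q / gcd(a,q)))`. [folklore] -/
theorem exists_class {a q : ℕ} (ha : 0 < a) (hq : 0 < q) (b : ℕ) :
    ∃ ρ : ℕ, ρ < q / Nat.gcd a q ∧
      ∀ n : ℕ, (q ∣ a * n + b ↔ (Nat.gcd a q ∣ b ∧ n ≡ ρ [MOD (q / Nat.gcd a q)])) := by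
  by_cases h : Nat.gcd a q ∣ b
  · obtain ⟨ρ, hρ, hiff⟩ := exists_class_of_dvd ha hq h
    exact ⟨ρ, hρ, fun n => by rw [hiff n]; exact ⟨fun h' => ⟨h, h'⟩, fun h' => h'.2⟩⟩
  · refine ⟨0, Nat.div_pos (Nat.le_of_dvd hq (Nat.gcd_dvd_right a q))
      (Nat.gcd_pos_of_pos_left q ha), fun n => ?_⟩
    exact ⟨fun h' => (no_solution_of_not_dvd h n h').elim, fun h' => (h h'.1).elim⟩

/-- `q / gcd(a, q) ≥ 1` for `a, q ≥ 1`. [folklore] -/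
theorem div_gcd_pos {a q : ℕ} (ha : 0 < a) (hq : 0 < q) : 0 < q / Nat.gcd a q :=
  Nat.div_pos (Nat.le_of_dvd hq (Nat.gcd_dvd_right a q)) (Nat.gcd_pos_of_pos_left q ha)

/-! ### Counting `n ≤ N` with `q ∣ a n + b` -/

/-- `#{1 ≤ n ≤ N : q ∣ a n + b} ≤ (a + b) N / q` for `a ≥ 1`: `n ↦ a n + b` injects into the multiples of
`q` in `[1, (a+b)N]`. [folklore] -/
theorem card_filter_dvd_linear_le {a : ℕ} (ha : 0 < a) (b q N : ℕ) :
    #((Icc 1 N).filter (fun n : ℕ => q ∣ a * n + b)) ≤ (a + b) * N / q := by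
  rw [← Nat.Ioc_filter_dvd_card_eq_div]
  refine Finset.card_le_card_of_injOn (fun n => a * n + b) (fun n hn => ?_) (fun n₁ _ n₂ _ h => ?_)
  · rw [Finset.mem_coe, Finset.mem_filter, Finset.mem_Icc] at hn
    rw [Finset.mem_coe, Finset.mem_filter, Finset.mem_Ioc]
    obtain ⟨⟨hn1, hnN⟩, hdvd⟩ := hn
    refine ⟨⟨?_, ?_⟩, hdvd⟩
    · have : 1 ≤ a * n := Nat.one_le_iff_ne_zero.mpr (Nat.mul_ne_zero ha.ne' (by omega))
      exact Nat.lt_of_lt_of_le this (Nat.le_add_right _ _)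
    · have h1 : a * n ≤ a * N := Nat.mul_le_mul_left a hnN
      have h2 : b ≤ b * N := Nat.le_mul_of_pos_right b (by omega)
      calc a * n + b ≤ a * N + b * N := Nat.add_le_add h1 h2
        _ = (a + b) * N := by ring
  · have : a * n₁ = a * n₂ := by
      have := h
      simp only at this
      omega
    exact Nat.eq_of_mul_eq_mul_left ha this

/-! ### Liouville bookkeeping and the squarefree switch -/

/-- `λ(e)² = 1` for `e ≠ 0` (as a real number). [folklore] -/
theorem liouville_sq_real {e : ℕ} (he : e ≠ 0) :
    ((ArithmeticFunction.liouville e : ℤ) : ℝ) ^ 2 = 1 := by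
  rw [ArithmeticFunction.liouville_apply he]
  push_cast
  rw [← pow_mul, mul_comm, pow_mul, neg_one_sq, one_pow]

/-- `|λ(e)| = 1` for `e ≠ 0` (as a real number). [folklore] -/
theorem abs_liouville_real_eq_one {e : ℕ} (he : e ≠ 0) :
    |((ArithmeticFunction.liouville e : ℤ) : ℝ)| = 1 := by
  have h := liouville_sq_real he
  rcases sq_eq_one_iff.mp h with h1 | h1 <;> rw [h1] <;> simp

/-- `|μ(n)| ≤ 1` (as a real number). [folklore] -/
theorem abs_moebius_real_le_one (n : ℕ) : |((μ n : ℤ) : ℝ)| ≤ 1 := by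
  exact_mod_cast ArithmeticFunction.abs_moebius_le_one

/-- Complete multiplicativity: `λ(k / e) = λ(k) λ(e)` when `e ∣ k`, `e ≠ 0`. [folklore] -/
theorem liouville_div_real {k e : ℕ} (he : e ≠ 0) (hek : e ∣ k) :
    ((ArithmeticFunction.liouville (k / e) : ℤ) : ℝ) =
      ((ArithmeticFunction.liouville k : ℤ) : ℝ) * ((ArithmeticFunction.liouville e : ℤ) : ℝ) := by
  have hk : k = e * (k / e) := (Nat.mul_div_cancel' hek).symm
  have hmul : ((ArithmeticFunction.liouville k : ℤ) : ℝ) =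
      ((ArithmeticFunction.liouville e : ℤ) : ℝ) * ((ArithmeticFunction.liouville (k / e) : ℤ) : ℝ) := by
    conv_lhs => rw [hk]
    rw [ArithmeticFunction.liouville_apply_mul]
    push_cast
    ring
  rw [hmul]
  have h2 := liouville_sq_real he
  calc ((ArithmeticFunction.liouville (k / e) : ℤ) : ℝ)
      = ((ArithmeticFunction.liouville (k / e) : ℤ) : ℝ) *
          ((ArithmeticFunction.liouville e : ℤ) : ℝ) ^ 2 := by rw [h2, mul_one]
    _ = ((ArithmeticFunction.liouville e : ℤ) : ℝ) * ((ArithmeticFunction.liouville (k / e) : ℤ) : ℝ) *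
          ((ArithmeticFunction.liouville e : ℤ) : ℝ) := by ring

/-- **The squarefree switch.** For `e ∣ k`, `k ≠ 0` and any `J ≥ k`:
`μ(k/e) = λ(k) λ(e) · Σ_{j ≤ J, e j² ∣ k} μ(j)` — from `μ(m) = λ(m) 𝟙_{sqfree}(m)`,
`𝟙_{sqfree}(m) = Σ_{j² ∣ m} μ(j)` and `j² ∣ k/e ↔ e j² ∣ k`. [folklore] -/
theorem moebius_div_eq_liouville_mul_sum {k e J : ℕ} (hk : k ≠ 0) (he : e ≠ 0) (hek : e ∣ k)
    (hJ : k ≤ J) :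
    ((μ (k / e) : ℤ) : ℝ) =
      ((ArithmeticFunction.liouville k : ℤ) : ℝ) * ((ArithmeticFunction.liouville e : ℤ) : ℝ) *
        ∑ j ∈ (Icc 1 J).filter (fun j : ℕ => e * j ^ 2 ∣ k), ((μ j : ℤ) : ℝ) := by
  have hke : 0 < k / e := Nat.div_pos (Nat.le_of_dvd (Nat.pos_of_ne_zero hk) hek) (Nat.pos_of_ne_zero he)
  have hkeJ : k / e ≤ J := (Nat.div_le_self k e).trans hJ
  rw [Literature.NumberTheory.LFunctions.moebius_eq_liouville_mul_sqfreeInd (k / e),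
    Literature.NumberTheory.LFunctions.sqfreeInd_eq_sum_moebius hke hkeJ, liouville_div_real he hek]
  congr 1
  refine Finset.sum_congr ?_ fun _ _ => rfl
  ext j
  simp only [Finset.mem_filter, and_congr_right_iff]
  intro _
  exact Nat.dvd_div_iff_mul_dvd hek

end RungAtoms

/-- **Registered sub-goal `stub_rungAtomsPart_part1`** (uncurried form of `moebius_div_eq_liouville_mul_sum`):
the squarefree switch `μ(k/e) = λ(k) λ(e) Σ_{j ≤ J, e j² ∣ k} μ(j)`. [folklore] -/
theorem stub_rungAtomsPart_part1 : ∀ (k e J : ℕ), k ≠ 0 → e ≠ 0 → e ∣ k → k ≤ J → ((ArithmeticFunction.moebius (k / e) : ℤ) : ℝ) = ((ArithmeticFunction.liouville k : ℤ) : ℝ) * ((ArithmeticFunction.liouville e : ℤ) : ℝ) * ∑ j ∈ (Finset.Icc 1 J).filter (fun j : ℕ => e * j ^ 2 ∣ k), ((ArithmeticFunction.moebius j : ℤ) : ℝ) :=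
  fun _ _ _ hk he hek hJ => RungAtoms.moebius_div_eq_liouville_mul_sum hk he hek hJ

end Summit.Parity.GeneralizedHardyLittlewood.Theorems.PairsToGHL.SlopedLadder
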